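import Summits.ValiantsHypothesis.ValiantsHypothesis.Theorems.DepthWindowNewtonSpan
import Summits.ValiantsHypothesis.ValiantsHypothesis.Theorems.DepthWindowHomComponents
import Mathlib.RingTheory.MvPolynomial.WeightedHomogeneous
import Mathlib.Combinatorics.Enumerative.Composition
import Mathlib.Combinatorics.Enumerative.Partition.Basic
import HarnessLib

/-!
# Route `DepthWindow`, g8 — truncated Newton identities modulo high weight (the algebra of
`HomRel k (2k)`, LST Lemma 11 in the tree's weighted gate-list model)

Route-independent algebra for the port of Limaye–Srinivasan–Tavenas homogenisation
(`HomRel 1 2`, and in fact `HomRel k (2k)` for every `k`) to the tree's gate lists.  One data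
definition, no `Prop` definitions:

* `below w n p` — the part of `p` of `w`-weight `< n` (the linear map `Σ_{e<n} (·)_e`);
  `coeff_below`.  "`p` vanishes below weight `n`" is the equation `below w n p = 0`
  (closed under `+`, scalars, sums; `below a p = 0 → below b q = 0 → below (a+b) (p q) = 0`;
  constant coefficient `0` and weights `≥ 1` give `below w 1 p = 0`); "`p ≡ q` modulo weight
  `≥ n`" is the equation `below w n p = below w n q` — a CONGRUENCE for `+`, scalars, `*`,
  list/finset products (`below_mul_congr`: low-weight coefficients of a product only see
  low-weight coefficients of the factors), and it determines the components of weight `< n`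
  (`weightedHomogeneousComponent_eq_of_below_eq`);
* `truncNewton` — **the truncated Newton identity**: if `below w 1 (A_i) = 0` for all `i`, then
  modulo weight `> d`, `Π_i (1 + A_i) ≡ Σ_{k ≤ d} Σ_{μ ⊢ k} c_{k,μ} • Π_{j ∈ μ} (Σ_i A_i ^ j)` with
  the rational coefficients of `e_k = Σ_μ c_{k,μ} p_μ` (`DepthWindowNewtonSpan`): only partitions
  of `k ≤ d` occur — product fan-in `≤ d` and `≤ (d+1)·2^d` product terms (`card_partition_le`)
  — WHATEVER the number of factors; this is what makes the size of the homogenised block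
  independent of the product fan-in;
* `card_partition_le n : |Partition n| ≤ 2^n`, `parts_card_le`, `le_of_mem_parts` — the counting
  behind the size and fan-in budget of the Newton gadget.

[cite: LimayeSrinivasanTavenas2025, Lemma 11, Lemma 19, Lemma 20] [cite: Strassen1973, §3]
-/

-- layout Summits/ValiantsHypothesis/ValiantsHypothesis forces the duplicated namespace component
set_option linter.dupNamespace false

namespace Summit.ValiantsHypothesis.ValiantsHypothesis.Theorems.DepthWindow

open MvPolynomial Finset
open Finsupp (weight)

/-! ### The low-weight part of a polynomial -/

section Below

variable {τ R : Type*} [CommSemiring R]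

/-- The part of `p` of `w`-weight `< n`: `Σ_{e < n} (p)_e`, as a linear map. [folklore] -/
noncomputable def below (w : τ → ℕ) (n : ℕ) : MvPolynomial τ R →ₗ[R] MvPolynomial τ R :=
  ∑ e ∈ Finset.range n, weightedHomogeneousComponent w e

variable (w : τ → ℕ)

/-- Unfolding `below` pointwise. -/
theorem below_apply (n : ℕ) (p : MvPolynomial τ R) :
    below w n p = ∑ e ∈ range n, weightedHomogeneousComponent w e p := by
  rw [below, LinearMap.sum_apply]

/-- Coefficients of the low-weight part. -/
theorem coeff_below (n : ℕ) (p : MvPolynomial τ R) (m : τ →₀ ℕ) :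
    coeff m (below w n p) = if weight w m < n then coeff m p else 0 := by
  classical
  rw [below_apply, coeff_sum]
  simp_rw [coeff_weightedHomogeneousComponent]
  rw [Finset.sum_ite_eq]
  simp only [Finset.mem_range]

/-- `below w n p = 0` iff every monomial of `p` has weight `≥ n`. -/
theorem below_eq_zero_iff {n : ℕ} {p : MvPolynomial τ R} :
    below w n p = 0 ↔ ∀ m : τ →₀ ℕ, weight w m < n → coeff m p = 0 := by
  constructor
  · intro h m hm
    have h' := congrArg (coeff m) h
    rwa [coeff_below, if_pos hm, coeff_zero] at h'
  · intro h
    ext m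
    rw [coeff_below, coeff_zero]
    split_ifs with hm
    · exact h m hm
    · rfl

/-- `below w n p = below w n q` iff `p` and `q` have the same coefficients in weight `< n`. -/
theorem below_eq_below_iff {n : ℕ} {p q : MvPolynomial τ R} :
    below w n p = below w n q ↔ ∀ m : τ →₀ ℕ, weight w m < n → coeff m p = coeff m q := by
  constructor
  · intro h m hm
    have h' := congrArg (coeff m) h
    rwa [coeff_below, coeff_below, if_pos hm, if_pos hm] at h'
  · intro h
    ext m
    rw [coeff_below, coeff_below]
    split_ifs with hm
    · exact h m hm
    · rfl

/-- Congruence below `n` determines the components of weight `< n`. -/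
theorem weightedHomogeneousComponent_eq_of_below_eq {n : ℕ} {p q : MvPolynomial τ R}
    (h : below w n p = below w n q) {e : ℕ} (he : e < n) :
    weightedHomogeneousComponent w e p = weightedHomogeneousComponent w e q := by
  classical
  ext m
  rw [coeff_weightedHomogeneousComponent, coeff_weightedHomogeneousComponent]
  split_ifs with hme
  · exact (below_eq_below_iff w).mp h m (hme ▸ he)
  · rfl

/-- Vanishing below `n` kills the components of weight `< n`. -/
theorem weightedHomogeneousComponent_eq_zero_of_below {n : ℕ} {p : MvPolynomial τ R}
    (h : below w n p = 0) {e : ℕ} (he : e < n) : weightedHomogeneousComponent w e p = 0 := by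
  have h' : below w n p = below w n 0 := by rw [h, map_zero]
  rw [weightedHomogeneousComponent_eq_of_below_eq w h' he, map_zero]

/-- Nothing lies below weight `0`. -/
theorem below_zero_left (p : MvPolynomial τ R) : below w 0 p = 0 := by
  rw [below_apply, Finset.range_zero, Finset.sum_empty]

/-- Monotonicity of vanishing. -/
theorem below_eq_zero_mono {n n' : ℕ} {p : MvPolynomial τ R} (h : below w n p = 0) (hn : n' ≤ n) :
    below w n' p = 0 :=
  (below_eq_zero_iff w).mpr fun m hm => (below_eq_zero_iff w).mp h m (lt_of_lt_of_le hm hn)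

/-- **Weights add under multiplication.** [folklore] -/
theorem below_mul_eq_zero {a b : ℕ} {p q : MvPolynomial τ R} (hp : below w a p = 0)
    (hq : below w b q = 0) : below w (a + b) (p * q) = 0 := by
  classical
  rw [below_eq_zero_iff] at hp hq ⊢
  intro m hm
  rw [coeff_mul]
  refine Finset.sum_eq_zero fun x hx => ?_
  have hx' : weight w x.1 + weight w x.2 = weight w m := by
    rw [← map_add, Finset.mem_antidiagonal.mp hx]
  by_cases h1 : weight w x.1 < a
  · rw [hp x.1 h1, zero_mul]
  · have h2 : weight w x.2 < b := by omega
    rw [hq x.2 h2, mul_zero]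

/-- Left multiples keep the vanishing weight. -/
theorem below_mul_eq_zero_left {n : ℕ} (p : MvPolynomial τ R) {q : MvPolynomial τ R}
    (hq : below w n q = 0) : below w n (p * q) = 0 := by
  have h := below_mul_eq_zero w (below_zero_left w p) hq
  rwa [zero_add] at h

/-- Right multiples keep the vanishing weight. -/
theorem below_mul_eq_zero_right {n : ℕ} {p : MvPolynomial τ R} (hp : below w n p = 0)
    (q : MvPolynomial τ R) : below w n (p * q) = 0 := by
  have h := below_mul_eq_zero w hp (below_zero_left w q)
  rwa [add_zero] at h

/-- Finite sums keep the vanishing weight. -/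
theorem below_sum_eq_zero {ι : Type*} {n : ℕ} (s : Finset ι) (f : ι → MvPolynomial τ R)
    (h : ∀ i ∈ s, below w n (f i) = 0) : below w n (∑ i ∈ s, f i) = 0 := by
  rw [map_sum]; exact Finset.sum_eq_zero h

/-- Finite products: the vanishing weights add up. -/
theorem below_prod_eq_zero {ι : Type*} (s : Finset ι) (n : ι → ℕ) (f : ι → MvPolynomial τ R)
    (h : ∀ i ∈ s, below w (n i) (f i) = 0) : below w (∑ i ∈ s, n i) (∏ i ∈ s, f i) = 0 := by
  induction s using Finset.cons_induction with
  | empty => simpa using below_zero_left w (1 : MvPolynomial τ R)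
  | cons a s ha ih =>
      rw [Finset.prod_cons, Finset.sum_cons]
      exact below_mul_eq_zero w (h a (Finset.mem_cons_self a s))
        (ih fun i hi => h i (Finset.mem_cons_of_mem hi))

/-- List products of factors vanishing below weight `1` vanish below the number of factors
(the zero-constant factors of a product gate). -/
theorem below_list_prod_eq_zero (l : List (MvPolynomial τ R)) (h : ∀ p ∈ l, below w 1 p = 0) :
    below w l.length l.prod = 0 := by
  induction l with
  | nil => simpa using below_zero_left w (1 : MvPolynomial τ R)
  | cons a l ih =>
      rw [List.length_cons, List.prod_cons, Nat.add_comm]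
      exact below_mul_eq_zero w (h a (by simp)) (ih fun p hp => h p (by simp [hp]))

/-- With weights `≥ 1`, a nonzero exponent vector has positive weight. -/
theorem weight_pos_of_ne_zero (hw : ∀ t, 1 ≤ w t) {m : τ →₀ ℕ} (hm : m ≠ 0) :
    0 < weight w m := by
  obtain ⟨t, ht⟩ : ∃ t, m t ≠ 0 := by
    by_contra h
    exact hm (Finsupp.ext fun t => by simpa using not_exists.mp h t)
  exact lt_of_lt_of_le (hw t) (Finsupp.le_weight_of_ne_zero' w ht)

/-- With weights `≥ 1`, constant coefficient `0` means vanishing below weight `1`. -/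
theorem below_one_of_coeff_zero (hw : ∀ t, 1 ≤ w t) {p : MvPolynomial τ R} (h : coeff 0 p = 0) :
    below w 1 p = 0 := by
  refine (below_eq_zero_iff w).mpr fun m hm => ?_
  by_cases hm0 : m = 0
  · rw [hm0]; exact h
  · exact absurd hm (not_lt.mpr (weight_pos_of_ne_zero w hw hm0))

/-! ### Congruence below a weight -/

/-- **Congruence for `*`**: coefficients of weight `< n` of a product only see coefficients of
weight `< n` of the factors. [cite: Strassen1973, §3] -/
theorem below_mul_congr {n : ℕ} {p p' q q' : MvPolynomial τ R} (hp : below w n p = below w n p')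
    (hq : below w n q = below w n q') : below w n (p * q) = below w n (p' * q') := by
  classical
  rw [below_eq_below_iff] at hp hq ⊢
  intro m hm
  rw [coeff_mul, coeff_mul]
  refine Finset.sum_congr rfl fun x hx => ?_
  have hx' : weight w x.1 + weight w x.2 = weight w m := by
    rw [← map_add, Finset.mem_antidiagonal.mp hx]
  rw [hp x.1 (by omega), hq x.2 (by omega)]

/-- Congruence for list products (the value of a product gate). -/
theorem below_list_prod_map_congr {α : Type*} {n : ℕ} (l : List α) (f g : α → MvPolynomial τ R)
    (h : ∀ a ∈ l, below w n (f a) = below w n (g a)) :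
    below w n (l.map f).prod = below w n (l.map g).prod := by
  induction l with
  | nil => rfl
  | cons a l ih =>
      rw [List.map_cons, List.map_cons, List.prod_cons, List.prod_cons]
      exact below_mul_congr w (h a (by simp)) (ih fun b hb => h b (by simp [hb]))

/-- Congruence for finite products. -/
theorem below_finset_prod_congr {ι : Type*} {n : ℕ} (s : Finset ι) (f g : ι → MvPolynomial τ R)
    (h : ∀ i ∈ s, below w n (f i) = below w n (g i)) :
    below w n (∏ i ∈ s, f i) = below w n (∏ i ∈ s, g i) := by
  induction s using Finset.cons_induction with
  | empty => simp
  | cons a s ha ih =>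
      rw [Finset.prod_cons, Finset.prod_cons]
      exact below_mul_congr w (h a (Finset.mem_cons_self a s))
        (ih fun i hi => h i (Finset.mem_cons_of_mem hi))

/-- Congruence for weighted list sums (the value of a sum gate). -/
theorem below_list_sum_map_congr {α : Type*} {n : ℕ} (l : List α) (c : α → R)
    (f g : α → MvPolynomial τ R) (h : ∀ a ∈ l, below w n (f a) = below w n (g a)) :
    below w n (l.map fun a => c a • f a).sum = below w n (l.map fun a => c a • g a).sum := by
  rw [map_list_sum, map_list_sum, List.map_map, List.map_map]
  congr 1
  refine List.map_congr_left fun a ha => ?_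
  simp only [Function.comp_apply, map_smul, h a ha]

/-- Adding something of weight `≥ n` does not change the part below `n`. -/
theorem below_add_of_below_eq_zero {n : ℕ} (p : MvPolynomial τ R) {r : MvPolynomial τ R}
    (hr : below w n r = 0) : below w n (p + r) = below w n p := by
  rw [map_add, hr, add_zero]

/-- Congruent polynomials (below a positive weight) have the same constant coefficient. -/
theorem coeff_zero_eq_of_below_eq {n : ℕ} (hn : 0 < n) {p q : MvPolynomial τ R}
    (h : below w n p = below w n q) : coeff 0 p = coeff 0 q :=
  (below_eq_below_iff w).mp h 0 (by rwa [map_zero])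

end Below

/-! ### Counting partitions (size and fan-in budget of the Newton gadget) -/

section Counting

/-- `|Partition n| ≤ 2 ^ n` (via compositions: `2^(n-1)`). [folklore] -/
theorem card_partition_le (n : ℕ) : Fintype.card (Nat.Partition n) ≤ 2 ^ n :=
  calc Fintype.card (Nat.Partition n) ≤ Fintype.card (Composition n) :=
        Fintype.card_le_of_surjective _ Nat.Partition.ofComposition_surj
    _ = 2 ^ (n - 1) := composition_card n
    _ ≤ 2 ^ n := Nat.pow_le_pow_right (by norm_num) (Nat.sub_le n 1)

/-- A multiset of positive naturals has at most `sum` elements. -/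
theorem multiset_card_le_sum (s : Multiset ℕ) (h : ∀ x ∈ s, 1 ≤ x) : Multiset.card s ≤ s.sum := by
  induction s using Multiset.induction_on with
  | empty => simp
  | cons a s ih =>
      rw [Multiset.card_cons, Multiset.sum_cons]
      have ha := h a (Multiset.mem_cons_self a s)
      have := ih fun x hx => h x (Multiset.mem_cons_of_mem hx)
      omega

/-- A partition of `n` has at most `n` parts. -/
theorem parts_card_le {n : ℕ} (μ : n.Partition) : Multiset.card μ.parts ≤ n := by
  have h := multiset_card_le_sum μ.parts fun x hx => μ.parts_pos hx
  rwa [μ.parts_sum] at h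

/-- Each part of a partition of `n` is at most `n`. -/
theorem le_of_mem_parts {n : ℕ} (μ : n.Partition) {j : ℕ} (hj : j ∈ μ.parts) : j ≤ n := by
  have h := Multiset.le_sum_of_mem hj
  rwa [μ.parts_sum] at h

end Counting

/-! ### The truncated Newton identity -/

section TruncNewton

variable {τ : Type*} {k : Type*} [CommRing k] [Algebra ℚ k]
variable {ι : Type*} [Fintype ι]

/-- `e_k(A)` vanishes below weight `k` when every `A_i` vanishes below weight `1`. -/
theorem below_aeval_esymm (w : τ → ℕ) (A : ι → MvPolynomial τ k) (hA : ∀ i, below w 1 (A i) = 0)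
    (kk : ℕ) : below w kk (aeval A (esymm ι ℚ kk)) = 0 := by
  classical
  rw [esymm, map_sum]
  refine below_sum_eq_zero w _ _ fun t ht => ?_
  rw [map_prod]
  simp only [aeval_X]
  rw [Finset.mem_powersetCard] at ht
  have h := below_prod_eq_zero w t (fun _ => 1) A fun i _ => hA i
  rw [Finset.sum_const, smul_eq_mul, mul_one, ht.2] at h
  exact h

/-- `e_k = 0` in fewer than `k` variables. -/
theorem esymm_eq_zero_of_card_lt {kk : ℕ} (h : Fintype.card ι < kk) : esymm ι ℚ kk = 0 := by
  rw [esymm, Finset.powersetCard_eq_empty.mpr (by rwa [Finset.card_univ]), Finset.sum_empty]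

/-- **Truncated Newton identity.**  For polynomials `A_i` vanishing below weight `1` (constant
coefficient `0`, weights `≥ 1`) and any truncation `d` there are rational coefficients `c_{k,μ}`
(those of `e_k = Σ_{μ ⊢ k} c_{k,μ} p_μ`) with
`Π_i (1 + A_i) ≡ Σ_{k ≤ d} Σ_{μ ⊢ k} c_{k,μ} • Π_{j ∈ μ} (Σ_i A_i ^ j)` below weight `d + 1`:
only partitions of `k ≤ d` occur, independently of the number of factors.
[cite: LimayeSrinivasanTavenas2025, Lemma 11] -/
theorem truncNewton (w : τ → ℕ) (d : ℕ) (A : ι → MvPolynomial τ k)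
    (hA : ∀ i, below w 1 (A i) = 0) :
    ∃ c : (kk : ℕ) → kk.Partition → ℚ,
      below w (d + 1) (∏ i, (1 + A i)) =
        below w (d + 1) (∑ kk ∈ range (d + 1), ∑ μ : kk.Partition,
          c kk μ • (μ.parts.map fun j => ∑ i, A i ^ j).prod) := by
  classical
  choose c hc using fun kk => exists_esymm_eq_sum_psumPart ι ℚ kk
  refine ⟨c, ?_⟩
  set F : ℕ → MvPolynomial τ k := fun kk => aeval A (esymm ι ℚ kk) with hF
  have hFμ : ∀ kk, F kk = ∑ μ : kk.Partition,
      c kk μ • (μ.parts.map fun j => ∑ i, A i ^ j).prod := by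
    intro kk
    show aeval A (esymm ι ℚ kk) = _
    rw [hc kk, map_sum]
    refine Finset.sum_congr rfl fun μ _ => ?_
    rw [map_smul, psumPart, map_multiset_prod, Multiset.map_map]
    congr 2
    refine Multiset.map_congr rfl fun j _ => ?_
    simp [psum]
  have hprod : ∏ i, (1 + A i) = ∑ kk ∈ range (Fintype.card ι + 1), F kk := by
    rw [Finset.prod_one_add, ← Finset.card_univ, Finset.powerset_card_disjiUnion,
      Finset.sum_disjiUnion]
    refine Finset.sum_congr rfl fun kk _ => ?_
    show _ = aeval A (esymm ι ℚ kk)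
    rw [esymm, map_sum]
    refine Finset.sum_congr rfl fun t _ => ?_
    rw [map_prod]
    simp
  set N := max (Fintype.card ι) d with hN
  have hzero : ∀ kk, Fintype.card ι < kk → F kk = 0 := fun kk hkk => by
    show aeval A (esymm ι ℚ kk) = 0
    rw [esymm_eq_zero_of_card_lt hkk, map_zero]
  have hext : ∑ kk ∈ range (Fintype.card ι + 1), F kk = ∑ kk ∈ range (N + 1), F kk := by
    refine Finset.sum_subset (fun kk hkk => ?_) (fun kk hkk hkk' => ?_)
    · rw [Finset.mem_range] at hkk ⊢; omega
    · rw [Finset.mem_range] at hkk hkk'; exact hzero kk (by omega)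
  have hsplit : ∑ kk ∈ range (N + 1), F kk =
      ∑ kk ∈ range (d + 1), F kk +
        ∑ kk ∈ (range (N + 1)).filter (fun kk => ¬ kk ≤ d), F kk := by
    rw [← Finset.sum_filter_add_sum_filter_not (range (N + 1)) (fun kk => kk ≤ d)]
    congr 1
    refine Finset.sum_congr ?_ fun _ _ => rfl
    ext kk
    simp only [Finset.mem_filter, Finset.mem_range]
    omega
  have hvb : below w (d + 1) (∑ kk ∈ (range (N + 1)).filter (fun kk => ¬ kk ≤ d), F kk) = 0 := by
    refine below_sum_eq_zero w _ _ fun kk hkk => ?_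
    rw [Finset.mem_filter] at hkk
    exact below_eq_zero_mono w (below_aeval_esymm w A hA kk) (by omega)
  have hrhs : (∑ kk ∈ range (d + 1), ∑ μ : kk.Partition,
      c kk μ • (μ.parts.map fun j => ∑ i, A i ^ j).prod) = ∑ kk ∈ range (d + 1), F kk :=
    Finset.sum_congr rfl fun kk _ => (hFμ kk).symm
  rw [hprod, hext, hsplit, hrhs]
  exact below_add_of_below_eq_zero w _ hvb

end TruncNewton

end Summit.ValiantsHypothesis.ValiantsHypothesis.Theorems.DepthWindow
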